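import Mathlib

/-!
# The Kummer order `A[z_0, …, z_{p-1}]` and its chart `φ(c) = y^{c₀} ∏_{i≠0} tᵢ^{cᵢ}`

Let `A → L` be an algebra into a field, `y ∈ L` with `y ^ p = ∏_{i ≤ m} tᵢ ^ aᵢ` (`tᵢ ∈ A`,
`p` prime), and `z_j = y ^ j / ∏ᵢ tᵢ ^ ⌊j aᵢ / p⌋` (`j < p`). This file collects the elementary
algebra of the Kummer order `R = A[z_0, …, z_{p-1}] ⊆ L` used to verify Kato's logarithmic
regularity of the chart `φ(c) = y^{c₀} ∏_{i≠0} tᵢ^{cᵢ}` on the monoid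
`P = {c ∈ ℤ^{m+1} | 0 ≤ c₀, 0 ≤ aᵢ c₀ + p cᵢ (i ≠ 0)}`
(`RadicialJungCleanModelsSufficeKummerOrderLogRegular.lean`):

* the master formula `y ^ n = (∏ᵢ tᵢ ^ ⌊n aᵢ/p⌋) · z_{n mod p}` (`kummer_pow_eq`), so
  `z_j ^ p = ∏ᵢ tᵢ ^ {(j aᵢ) mod p}` and `φ(c) = z_{c₀ mod p} · ∏ᵢ tᵢ ^ {eᵢ}` with
  `eᵢ = ⌊c₀ aᵢ / p⌋ + cᵢ` (`i ≠ 0`), `e₀ = ⌊c₀ a₀ / p⌋` (`kummer_factor`);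
* Frobenius: in characteristic `p`, `R ^ p ⊆ A` (`kummer_pow_mem`); hence units of `A` are
  detected in `R`, the `z_j` (`0 < j`) are nonunits as soon as some `tᵢ` with `p ∤ j aᵢ` is a
  nonunit, and the units among the `φ(c)` are read off the factorisation (`kummer_of_isUnit`);
* the ideal `J = (z_1, …, z_{p-1}) + (tᵢ : tᵢ nonunit)` contains every nonunit `φ(c)`,
  `R = A + J`, and Frobenius maps an ideal generated by elements with `p`-th power in `𝔞 A`
  into `𝔞` (`kummer_pow_mem_of_mem_span`).

No use is made of the freeness of `R` over `A`.
-/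

set_option linter.dupNamespace false -- the mandated summit namespace repeats a component

namespace Summit.ResolutionOfSingularities.ResolutionOfSingularities.Theorems.RadicialJung.CleanModelsSuffice

variable {A L : Type} [CommRing A] [Field L] [Algebra A L] {p m : ℕ}
  {t : Fin (m + 1) → A} {a : Fin (m + 1) → ℕ} {y : L} {z : Fin p → L}

/-! ### Arithmetic of the generators `z_j` -/

/-- The master formula of the Kummer order: `y ^ n = (∏ᵢ tᵢ ^ ⌊n aᵢ / p⌋) · z_{n mod p}` for every
`n`, where `z_j = y ^ j / ∏ᵢ tᵢ ^ ⌊j aᵢ / p⌋` and `y ^ p = ∏ᵢ tᵢ ^ aᵢ`. -/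
theorem kummer_pow_eq (hp : p.Prime) (hyp : y ^ p = algebraMap A L (∏ i, t i ^ a i))
    (hz : ∀ j, z j = y ^ (j : ℕ) / algebraMap A L (∏ i, t i ^ ((j : ℕ) * a i / p)))
    (hne : ∀ e : Fin (m + 1) → ℕ, algebraMap A L (∏ i, t i ^ e i) ≠ 0) (n : ℕ) :
    y ^ n = algebraMap A L (∏ i, t i ^ (n * a i / p)) * z ⟨n % p, Nat.mod_lt n hp.pos⟩ := by
  have key : (∏ i, t i ^ a i) ^ (n / p) * ∏ i, t i ^ (n % p * a i / p) =
      ∏ i, t i ^ (n * a i / p) := by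
    rw [← Finset.prod_pow, ← Finset.prod_mul_distrib]
    refine Finset.prod_congr rfl fun i _ => ?_
    rw [← pow_mul, ← pow_add]
    congr 1
    conv_rhs => rw [← Nat.div_add_mod n p]
    rw [Nat.add_mul, mul_assoc, Nat.mul_add_div hp.pos, mul_comm]
  rw [hz, ← key, map_mul, map_pow, ← hyp, Fin.val_mk, mul_assoc, mul_div_cancel₀ _ (hne _),
    ← pow_mul, ← pow_add, Nat.div_add_mod]

/-- `z_j ^ p = ∏ᵢ tᵢ ^ ((j aᵢ) mod p)`. -/
theorem kummer_z_pow (hyp : y ^ p = algebraMap A L (∏ i, t i ^ a i))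
    (hz : ∀ j, z j = y ^ (j : ℕ) / algebraMap A L (∏ i, t i ^ ((j : ℕ) * a i / p)))
    (hne : ∀ e : Fin (m + 1) → ℕ, algebraMap A L (∏ i, t i ^ e i) ≠ 0) (j : Fin p) :
    z j ^ p = algebraMap A L (∏ i, t i ^ ((j : ℕ) * a i % p)) := by
  rw [hz, div_pow, ← pow_mul, mul_comm, pow_mul, hyp, div_eq_iff (pow_ne_zero _ (hne _)),
    ← map_pow, ← map_pow, ← map_mul]
  congr 1
  rw [← Finset.prod_pow, ← Finset.prod_pow, ← Finset.prod_mul_distrib]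
  refine Finset.prod_congr rfl fun i _ => ?_
  rw [← pow_mul, ← pow_mul, ← pow_add]
  congr 1
  rw [mul_comm (a i), Nat.mod_add_div']

/-- `z_0 = 1`. -/
theorem kummer_z_zero (hp : p.Prime)
    (hz : ∀ j, z j = y ^ (j : ℕ) / algebraMap A L (∏ i, t i ^ ((j : ℕ) * a i / p))) :
    z ⟨0, hp.pos⟩ = 1 := by
  simp [hz]

/-- If `0 < j < p` and `1 ≤ aᵢ < p` then `tᵢ` divides `∏ₖ tₖ ^ ((j aₖ) mod p)`. -/
theorem kummer_dvd_prod_mod (hp : p.Prime) {j : ℕ} (hj0 : j ≠ 0) (hjp : j < p) {i : Fin (m + 1)}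
    (hai : 1 ≤ a i ∧ a i < p) : t i ∣ ∏ k, t k ^ (j * a k % p) := by
  refine (dvd_pow_self (t i) fun h => ?_).trans (Finset.dvd_prod_of_mem _ (Finset.mem_univ i))
  have hdvd : p ∣ j * a i := Nat.dvd_of_mod_eq_zero h
  rcases (Nat.Prime.dvd_mul hp).mp hdvd with h' | h'
  · exact absurd (Nat.le_of_dvd (Nat.pos_of_ne_zero hj0) h') (not_le.mpr hjp)
  · exact absurd (Nat.le_of_dvd hai.1 h') (not_le.mpr hai.2)

/-! ### Frobenius: `R ^ p ⊆ A`; units and nonunits of the Kummer order -/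

/-- Frobenius maps the Kummer order `R = A[z_0, …, z_{p-1}]` into `A` (characteristic `p`): every
`x ∈ R` has `x ^ p ∈ A`. -/
theorem kummer_pow_mem [Fact p.Prime] [CharP L p] (hzp : ∀ j, ∃ b : A, z j ^ p = algebraMap A L b)
    {x : L} (hx : x ∈ Algebra.adjoin A (Set.range z)) : ∃ b : A, x ^ p = algebraMap A L b := by
  induction hx using Algebra.adjoin_induction with
  | mem x hx =>
    obtain ⟨j, rfl⟩ := hx
    exact hzp j
  | algebraMap r => exact ⟨r ^ p, by rw [map_pow]⟩
  | add x x' _ _ hx hx' =>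
    obtain ⟨b, hb⟩ := hx
    obtain ⟨b', hb'⟩ := hx'
    exact ⟨b + b', by rw [add_pow_char, hb, hb', map_add]⟩
  | mul x x' _ _ hx hx' =>
    obtain ⟨b, hb⟩ := hx
    obtain ⟨b', hb'⟩ := hx'
    exact ⟨b * b', by rw [mul_pow, hb, hb', map_mul]⟩

/-- Units of `A` are detected in the Kummer order: if `x ∈ A` becomes a unit of `R` then `x` is a
unit of `A` (apply Frobenius, `R ^ p ⊆ A`). -/
theorem kummer_isUnit_of_isUnit_algebraMap [Fact p.Prime] [CharP L p]
    (hinj : Function.Injective (algebraMap A L))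
    (hzp : ∀ j, ∃ b : A, z j ^ p = algebraMap A L b) {x : A}
    (hx : IsUnit (algebraMap A (Algebra.adjoin A (Set.range z)) x)) : IsUnit x := by
  obtain ⟨r, hr⟩ := hx.exists_right_inv
  obtain ⟨b, hb⟩ := kummer_pow_mem hzp r.2
  have h1 : algebraMap A L x * (r : L) = 1 := by
    have := congrArg (fun s : Algebra.adjoin A (Set.range z) => (s : L)) hr
    simpa using this
  have h2 : x ^ p * b = 1 :=
    hinj (by rw [map_mul, map_pow, ← hb, ← mul_pow, h1, one_pow, map_one])
  exact (isUnit_pow_iff (Fact.out : p.Prime).ne_zero).mp (IsUnit.of_mul_eq_one _ h2)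

/-- For `0 < j < p` the generator `z_j` is not a unit of the Kummer order as soon as some `tᵢ`
with `1 ≤ aᵢ < p` is a nonunit of `A`: `z_j ^ p = ∏ₖ tₖ ^ ((j aₖ) mod p)` is divisible by `tᵢ`. -/
theorem kummer_not_isUnit_z [Fact p.Prime] [CharP L p]
    (hinj : Function.Injective (algebraMap A L))
    (hyp : y ^ p = algebraMap A L (∏ i, t i ^ a i))
    (hz : ∀ j, z j = y ^ (j : ℕ) / algebraMap A L (∏ i, t i ^ ((j : ℕ) * a i / p)))
    (hne : ∀ e : Fin (m + 1) → ℕ, algebraMap A L (∏ i, t i ^ e i) ≠ 0)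
    {i : Fin (m + 1)} (hti : ¬ IsUnit (t i)) (hai : 1 ≤ a i ∧ a i < p)
    {j : Fin p} (hj : (j : ℕ) ≠ 0) :
    ¬ IsUnit (⟨z j, Algebra.subset_adjoin ⟨j, rfl⟩⟩ : Algebra.adjoin A (Set.range z)) := by
  have hp : p.Prime := Fact.out
  intro hu
  have hu' := hu.pow p
  have heq : (⟨z j, Algebra.subset_adjoin ⟨j, rfl⟩⟩ : Algebra.adjoin A (Set.range z)) ^ p =
      algebraMap A _ (∏ k, t k ^ ((j : ℕ) * a k % p)) :=
    Subtype.ext (by simpa using kummer_z_pow hyp hz hne j)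
  rw [heq] at hu'
  exact hti (isUnit_of_dvd_unit (kummer_dvd_prod_mod hp hj j.2 hai)
    (kummer_isUnit_of_isUnit_algebraMap hinj (fun k => ⟨_, kummer_z_pow hyp hz hne k⟩) hu'))

/-! ### The factorisation of the chart `φ(c) = y ^ {c₀} ∏_{i ≠ 0} tᵢ ^ {cᵢ}` -/

/-- The `t`-exponents of `φ(c) / z_{c₀ mod p}` on `P = {c | 0 ≤ c₀, 0 ≤ aᵢ c₀ + p cᵢ (i ≠ 0)}`:
the integers `eᵢ(c) = ⌊c₀ aᵢ / p⌋ + cᵢ` (`i ≠ 0`), `e₀(c) = ⌊c₀ a₀ / p⌋` are nonnegative, so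
they are the casts of a vector of natural numbers. -/
theorem kummer_exists_exp (hp : p.Prime) {c : Fin (m + 1) → ℤ} (hc0 : 0 ≤ c 0)
    (hci : ∀ i, i ≠ 0 → 0 ≤ (a i : ℤ) * c 0 + (p : ℤ) * c i) : ∃ e : Fin (m + 1) → ℕ,
    ∀ i, ((e i : ℕ) : ℤ) = ((c 0).toNat * a i / p : ℕ) + if i = 0 then 0 else c i := by
  refine ⟨fun i => ((((c 0).toNat * a i / p : ℕ) : ℤ) + if i = 0 then 0 else c i).toNat,
    fun i => Int.toNat_of_nonneg ?_⟩
  split_ifs with hi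
  · positivity
  · set n := (c 0).toNat with hn_def
    have hn : (n : ℤ) = c 0 := Int.toNat_of_nonneg hc0
    have hci' := hci i hi
    rw [← hn] at hci'
    have hdm : (p : ℤ) * ((n * a i / p : ℕ) : ℤ) + ((n * a i % p : ℕ) : ℤ) = (n : ℤ) * (a i) := by
      exact_mod_cast Nat.div_add_mod (n * a i) p
    have hr : ((n * a i % p : ℕ) : ℤ) < p := by exact_mod_cast Nat.mod_lt _ hp.pos
    have h1 : (p : ℤ) * (-1) < (p : ℤ) * (((n * a i / p : ℕ) : ℤ) + c i) := by
      have : (p : ℤ) * (((n * a i / p : ℕ) : ℤ) + c i) =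
          ((a i : ℤ) * n + p * c i) - ((n * a i % p : ℕ) : ℤ) := by linear_combination hdm
      rw [this]
      linarith
    have h2 := lt_of_mul_lt_mul_left h1 (by exact_mod_cast hp.pos.le)
    omega

/-- **Factorisation of the Kummer chart**: for `c ∈ P` with exponent vector `e`,
`y ^ {c₀} ∏_{i ≠ 0} tᵢ ^ {cᵢ} = z_{c₀ mod p} · ∏ᵢ tᵢ ^ {eᵢ}`. -/
theorem kummer_factor {A L : Type} [CommRing A] [Field L] [Algebra A L] {p m : ℕ}
    {t : Fin (m + 1) → A} {a : Fin (m + 1) → ℕ} {y : L} {z : Fin p → L} (hp : p.Prime)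
    (hyp : y ^ p = algebraMap A L (∏ i, t i ^ a i))
    (hz : ∀ j, z j = y ^ (j : ℕ) / algebraMap A L (∏ i, t i ^ ((j : ℕ) * a i / p)))
    (hne : ∀ e : Fin (m + 1) → ℕ, algebraMap A L (∏ i, t i ^ e i) ≠ 0)
    (ht0 : ∀ i, algebraMap A L (t i) ≠ 0) {c : Fin (m + 1) → ℤ} (hc0 : 0 ≤ c 0)
    {e : Fin (m + 1) → ℕ}
    (he : ∀ i, ((e i : ℕ) : ℤ) = ((c 0).toNat * a i / p : ℕ) + if i = 0 then 0 else c i) :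
    y ^ (c 0) * ∏ i ∈ Finset.univ.erase 0, algebraMap A L (t i) ^ (c i) =
      z ⟨(c 0).toNat % p, Nat.mod_lt _ hp.pos⟩ * algebraMap A L (∏ i, t i ^ e i) := by
  set n := (c 0).toNat with hn_def
  have hn : (n : ℤ) = c 0 := Int.toNat_of_nonneg hc0
  have hR : algebraMap A L (∏ i, t i ^ e i) = algebraMap A L (∏ i, t i ^ (n * a i / p)) *
      ∏ i ∈ Finset.univ.erase 0, algebraMap A L (t i) ^ c i := by
    have h1 : ∀ i, algebraMap A L (t i ^ e i) = algebraMap A L (t i ^ (n * a i / p)) *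
        algebraMap A L (t i) ^ (if i = 0 then (0 : ℤ) else c i) := by
      intro i
      rw [map_pow, map_pow, ← zpow_natCast, he i, zpow_add₀ (ht0 i), zpow_natCast]
    have h2 : ∏ i, algebraMap A L (t i) ^ (if i = 0 then (0 : ℤ) else c i) =
        ∏ i ∈ Finset.univ.erase 0, algebraMap A L (t i) ^ c i := by
      rw [← Finset.mul_prod_erase _ _ (Finset.mem_univ (0 : Fin (m + 1))), if_pos rfl, zpow_zero,
        one_mul]
      exact Finset.prod_congr rfl fun i hi => by rw [if_neg (Finset.ne_of_mem_erase hi)]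
    rw [map_prod, map_prod, ← h2, ← Finset.prod_mul_distrib]
    exact Finset.prod_congr rfl fun i _ => h1 i
  rw [hR, ← hn, zpow_natCast, kummer_pow_eq hp hyp hz hne n]
  ring

/-- The factorisation of `φ(c)` inside the Kummer order `R`. -/
theorem kummer_factor_mk (hp : p.Prime) (hyp : y ^ p = algebraMap A L (∏ i, t i ^ a i))
    (hz : ∀ j, z j = y ^ (j : ℕ) / algebraMap A L (∏ i, t i ^ ((j : ℕ) * a i / p)))
    (hne : ∀ e : Fin (m + 1) → ℕ, algebraMap A L (∏ i, t i ^ e i) ≠ 0)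
    (ht0 : ∀ i, algebraMap A L (t i) ≠ 0) {c : Fin (m + 1) → ℤ} (hc0 : 0 ≤ c 0)
    {e : Fin (m + 1) → ℕ}
    (he : ∀ i, ((e i : ℕ) : ℤ) = ((c 0).toNat * a i / p : ℕ) + if i = 0 then 0 else c i)
    (x : Algebra.adjoin A (Set.range z))
    (hx : (x : L) = y ^ (c 0) * ∏ i ∈ Finset.univ.erase 0, algebraMap A L (t i) ^ (c i)) :
    x = ⟨z ⟨(c 0).toNat % p, Nat.mod_lt _ hp.pos⟩, Algebra.subset_adjoin ⟨_, rfl⟩⟩ *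
      algebraMap A (Algebra.adjoin A (Set.range z)) (∏ i, t i ^ e i) :=
  Subtype.ext (by rw [hx, kummer_factor hp hyp hz hne ht0 hc0 he]; rfl)

/-- **Units of the chart.** If `φ(c)` is a unit of `R` (and some `tᵢ` with `1 ≤ aᵢ < p` is a
nonunit of `A`), then `p ∣ c₀` and the exponent `eᵢ(c)` vanishes at every nonunit `tᵢ`. -/
theorem kummer_of_isUnit [Fact p.Prime] [CharP L p] (hinj : Function.Injective (algebraMap A L))
    (hyp : y ^ p = algebraMap A L (∏ i, t i ^ a i))
    (hz : ∀ j, z j = y ^ (j : ℕ) / algebraMap A L (∏ i, t i ^ ((j : ℕ) * a i / p)))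
    (hne : ∀ e : Fin (m + 1) → ℕ, algebraMap A L (∏ i, t i ^ e i) ≠ 0)
    (ht0 : ∀ i, algebraMap A L (t i) ≠ 0) {i₀ : Fin (m + 1)} (hti₀ : ¬ IsUnit (t i₀))
    (hai₀ : 1 ≤ a i₀ ∧ a i₀ < p) {c : Fin (m + 1) → ℤ} (hc0 : 0 ≤ c 0) {e : Fin (m + 1) → ℕ}
    (he : ∀ i, ((e i : ℕ) : ℤ) = ((c 0).toNat * a i / p : ℕ) + if i = 0 then 0 else c i)
    (x : Algebra.adjoin A (Set.range z))
    (hx : (x : L) = y ^ (c 0) * ∏ i ∈ Finset.univ.erase 0, algebraMap A L (t i) ^ (c i))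
    (hu : IsUnit x) : (c 0).toNat % p = 0 ∧ ∀ i, ¬ IsUnit (t i) → e i = 0 := by
  have hp : p.Prime := Fact.out
  rw [kummer_factor_mk hp hyp hz hne ht0 hc0 he x hx, IsUnit.mul_iff] at hu
  refine ⟨?_, fun i hti => ?_⟩
  · by_contra hj
    exact kummer_not_isUnit_z hinj hyp hz hne hti₀ hai₀ hj hu.1
  · have hu2 := kummer_isUnit_of_isUnit_algebraMap hinj
      (fun k => ⟨_, kummer_z_pow hyp hz hne k⟩) hu.2
    rw [IsUnit.prod_univ_iff] at hu2
    by_contra hk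
    exact hti ((isUnit_pow_iff hk).mp (hu2 i))

/-! ### The ideal `J = (z_1, …, z_{p-1}) + (tᵢ : tᵢ ∉ Aˣ)` -/

/-- A nonunit `φ(c)` lies in every ideal containing the `z_j` (`0 < j < p`) and the nonunits
among the `tᵢ`. -/
theorem kummer_mem_of_not_isUnit (hp : p.Prime) (hyp : y ^ p = algebraMap A L (∏ i, t i ^ a i))
    (hz : ∀ j, z j = y ^ (j : ℕ) / algebraMap A L (∏ i, t i ^ ((j : ℕ) * a i / p)))
    (hne : ∀ e : Fin (m + 1) → ℕ, algebraMap A L (∏ i, t i ^ e i) ≠ 0)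
    (ht0 : ∀ i, algebraMap A L (t i) ≠ 0) {J : Ideal (Algebra.adjoin A (Set.range z))}
    (hJz : ∀ j : Fin p, (j : ℕ) ≠ 0 → (⟨z j, Algebra.subset_adjoin ⟨j, rfl⟩⟩ : _) ∈ J)
    (hJt : ∀ i, ¬ IsUnit (t i) → algebraMap A _ (t i) ∈ J) {c : Fin (m + 1) → ℤ}
    (hc0 : 0 ≤ c 0) (hci : ∀ i, i ≠ 0 → 0 ≤ (a i : ℤ) * c 0 + (p : ℤ) * c i)
    (x : Algebra.adjoin A (Set.range z))
    (hx : (x : L) = y ^ (c 0) * ∏ i ∈ Finset.univ.erase 0, algebraMap A L (t i) ^ (c i))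
    (hu : ¬ IsUnit x) : x ∈ J := by
  obtain ⟨e, he⟩ := kummer_exists_exp (a := a) hp hc0 hci
  have hfac := kummer_factor_mk hp hyp hz hne ht0 hc0 he x hx
  by_cases hj : (c 0).toNat % p = 0
  · have hfin : (⟨(c 0).toNat % p, Nat.mod_lt _ hp.pos⟩ : Fin p) = ⟨0, hp.pos⟩ := Fin.ext hj
    have h1 : (⟨z ⟨(c 0).toNat % p, Nat.mod_lt _ hp.pos⟩, Algebra.subset_adjoin ⟨_, rfl⟩⟩ :
        Algebra.adjoin A (Set.range z)) = 1 :=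
      Subtype.ext (by rw [hfin]; exact kummer_z_zero hp hz)
    rw [h1, one_mul] at hfac
    rw [hfac] at hu ⊢
    have hu' : ¬ IsUnit (∏ i, t i ^ e i) := fun h => hu (h.map _)
    rw [IsUnit.prod_univ_iff, not_forall] at hu'
    obtain ⟨k, hk⟩ := hu'
    have hk0 : e k ≠ 0 := fun h0 => hk (by rw [h0, pow_zero]; exact isUnit_one)
    have htk : ¬ IsUnit (t k) := fun h => hk (h.pow _)
    obtain ⟨w, hw⟩ := (dvd_pow_self (t k) hk0).trans
      (Finset.dvd_prod_of_mem (fun k => t k ^ e k) (Finset.mem_univ k))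
    rw [hw, map_mul]
    exact Ideal.mul_mem_right _ _ (hJt k htk)
  · rw [hfac]
    exact Ideal.mul_mem_right _ _ (hJz _ hj)

/-- `R = A · 1 + J` for every ideal `J` of the Kummer order containing `z_1, …, z_{p-1}`. -/
theorem kummer_exists_sub_mem (hp : p.Prime)
    (hz : ∀ j, z j = y ^ (j : ℕ) / algebraMap A L (∏ i, t i ^ ((j : ℕ) * a i / p)))
    {J : Ideal (Algebra.adjoin A (Set.range z))}
    (hJz : ∀ j : Fin p, (j : ℕ) ≠ 0 → (⟨z j, Algebra.subset_adjoin ⟨j, rfl⟩⟩ : _) ∈ J)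
    (x : Algebra.adjoin A (Set.range z)) : ∃ b : A, x - algebraMap A _ b ∈ J := by
  obtain ⟨x, hx⟩ := x
  induction hx using Algebra.adjoin_induction with
  | mem x hx =>
    obtain ⟨j, rfl⟩ := hx
    by_cases hj : (j : ℕ) = 0
    · refine ⟨1, ?_⟩
      have hj' : j = ⟨0, hp.pos⟩ := Fin.ext hj
      have : (⟨z j, Algebra.subset_adjoin ⟨j, rfl⟩⟩ : Algebra.adjoin A (Set.range z)) = 1 :=
        Subtype.ext (by rw [hj']; exact kummer_z_zero hp hz)
      rw [this, map_one, sub_self]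
      exact zero_mem _
    · refine ⟨0, ?_⟩
      rw [map_zero, sub_zero]
      exact hJz j hj
  | algebraMap r =>
    refine ⟨r, ?_⟩
    rw [show (⟨algebraMap A L r, Subalgebra.algebraMap_mem _ r⟩ : Algebra.adjoin A (Set.range z)) =
      algebraMap A _ r from Subtype.ext rfl, sub_self]
    exact zero_mem _
  | add x x' hx hx' ih ih' =>
    obtain ⟨b, hb⟩ := ih
    obtain ⟨b', hb'⟩ := ih'
    refine ⟨b + b', ?_⟩
    have : (⟨x + x', add_mem hx hx'⟩ : Algebra.adjoin A (Set.range z)) - algebraMap A _ (b + b') =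
        (⟨x, hx⟩ - algebraMap A _ b) + (⟨x', hx'⟩ - algebraMap A _ b') := by
      rw [map_add]; exact Subtype.ext (by push_cast; ring)
    rw [this]
    exact add_mem hb hb'
  | mul x x' hx hx' ih ih' =>
    obtain ⟨b, hb⟩ := ih
    obtain ⟨b', hb'⟩ := ih'
    refine ⟨b * b', ?_⟩
    have : (⟨x * x', mul_mem hx hx'⟩ : Algebra.adjoin A (Set.range z)) - algebraMap A _ (b * b') =
        ⟨x, hx⟩ * (⟨x', hx'⟩ - algebraMap A _ b') +
          (⟨x, hx⟩ - algebraMap A _ b) * algebraMap A _ b' := by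
      rw [map_mul]; exact Subtype.ext (by push_cast; ring)
    rw [this]
    exact add_mem (Ideal.mul_mem_left _ _ hb') (Ideal.mul_mem_right _ _ hb)

/-- Frobenius maps the ideal generated by a set `G ⊆ R` into `𝔞 A ⊆ A` as soon as it maps `G`
there: `x ∈ (G) ⇒ x ^ p ∈ 𝔞`. -/
theorem kummer_pow_mem_of_mem_span [Fact p.Prime] [CharP L p]
    (hzp : ∀ j, ∃ b : A, z j ^ p = algebraMap A L b) {𝔞 : Ideal A}
    {G : Set (Algebra.adjoin A (Set.range z))}
    (hG : ∀ g ∈ G, ∃ b ∈ 𝔞, (g : L) ^ p = algebraMap A L b)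
    {x : Algebra.adjoin A (Set.range z)} (hx : x ∈ Ideal.span G) :
    ∃ b ∈ 𝔞, (x : L) ^ p = algebraMap A L b := by
  have hp : p.Prime := Fact.out
  induction hx using Submodule.span_induction with
  | mem x hx => exact hG x hx
  | zero => exact ⟨0, zero_mem _, by simp [hp.ne_zero]⟩
  | add x x' _ _ ih ih' =>
    obtain ⟨b, hb, he⟩ := ih
    obtain ⟨b', hb', he'⟩ := ih'
    refine ⟨b + b', add_mem hb hb', ?_⟩
    rw [Subalgebra.coe_add, add_pow_char, he, he', map_add]
  | smul r x _ ih =>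
    obtain ⟨b, hb, he⟩ := ih
    obtain ⟨b', hb'⟩ := kummer_pow_mem hzp r.2
    refine ⟨b' * b, Ideal.mul_mem_left _ _ hb, ?_⟩
    rw [smul_eq_mul, Subalgebra.coe_mul, mul_pow, hb', he, map_mul]

end Summit.ResolutionOfSingularities.ResolutionOfSingularities.Theorems.RadicialJung.CleanModelsSuffice
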